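import Summits.NavierStokesRegularity.NavierStokesRegularity.Theses.OddMorawetz
import Literature.Analysis.FluidPDE.KNSSLocalSmoothingHolds
import Literature.Analysis.FluidPDE.EulerTimeScaling

/-!
# Route OddMorawetz — `OddNoGoNS` (item stmt-NavierStokesRegularity-1378)

The odd half of the Lyapunov no-go for Navier–Stokes, by **amplitude scaling**.

Fix `ν > 0` and a smooth density `m` on 3-jets which is a cubic form, `m (μ z) = μ³ m z`. With
`J v x = (v x, ∇v x, ∇²v x, ∇³v x)`, `Q v = -∫ Dm(J v x)[J B(v,v) x] dx` (`B = eulerBilinear`,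
the Leray-projected nonlinearity) and `V v = ∫ Dm(J v x)[J Δv x] dx`, so that formally
`d/dt M = ν V - Q` along Navier–Stokes: if `ν V v - Q v ≤ 0` for every divergence-free Schwartz
field `v`, then `V v = 0` and `0 ≤ Q v` for every such `v`.

## Proof

Everything in sight is homogeneous under `v ↦ μ • v` without any integrability or
differentiability bookkeeping:

* `J (μ • w) x = μ • J w x` for *every* field `w` (constants come out of `iteratedFDeriv` with no
  differentiability hypothesis, tree lemma `iteratedFDeriv_const_smul_real`);
* `B(μ • v, μ • v) = μ² • B(v, v)` as functions (the convective term is `2`-homogeneous by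
  `fderiv_const_smul_real`, and the function-level Leray projector `lerayProjFun` is homogeneous
  because Bochner integrals are: `∫ c • f = c • ∫ f` unconditionally);
* `Δ (μ • v) = μ • Δ v` (the Laplacian is a sum of second `iteratedFDeriv`s);
* `Dm(μ • z) = μ² • Dm(z)` for `μ ≠ 0` (differentiate `m (μ z) = μ³ m z`).

Hence `Q (μ • v) = μ⁴ Q v` and `V (μ • v) = μ³ V v` for `μ ≠ 0`, and divergence-free Schwartz
fields are stable under `μ •`. The hypothesis at `± t • v`, `t > 0`, divided by `t³`, reads
`± ν V v ≤ t Q v`; letting `t → 0` gives `V v = 0`, and then the hypothesis at `v` itself gives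
`0 ≤ Q v`.

## References

* Idea cards `morawetz-hunt-odd-virial`, `no-strict-even-lyapunov` (route OddMorawetz, thesis).
-/

noncomputable section

open Literature.Analysis.FluidPDE MeasureTheory Set Function Filter Topology
open scoped InnerProductSpace RealInnerProductSpace Laplacian FourierTransform

namespace Summit.NavierStokesRegularity.NavierStokesRegularity.Theorems

/-! ### Homogeneity of the function-level Leray projector and of `eulerBilinear` -/

section Leray

variable {ι : Type*} [Fintype ι]

omit [Fintype ι] in
/-- The real part commutes with real scalars: `Re ((c : ℂ) • z) = c • Re z`. -/
theorem oddNoGoNS_realPart_ofReal_smul (c : ℝ) (z : EuclideanSpace ℂ ι) :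
    realPart ((c : ℂ) • z) = c • realPart z := by
  ext i
  simp only [realPart_apply, PiLp.smul_apply, smul_eq_mul, Complex.re_ofReal_mul]

/-- The complexified Leray symbol is `ℂ`-linear in the frequency vector. -/
theorem oddNoGoNS_leraySymbolC_smul (ξ : EuclideanSpace ℝ ι) (c : ℂ) (z : EuclideanSpace ℂ ι) :
    leraySymbolC ξ (c • z) = c • leraySymbolC ξ z := by
  unfold leraySymbolC
  have h : (∑ i, (ξ i : ℂ) * (c • z) i) = c * ∑ i, (ξ i : ℂ) * z i := by
    rw [Finset.mul_sum]
    refine Finset.sum_congr rfl fun i _ => ?_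
    rw [PiLp.smul_apply, smul_eq_mul]
    ring
  rw [h, smul_sub, smul_smul, mul_div_assoc]

/-- The vector Fourier transform is homogeneous: `𝓕[c • w] = c • 𝓕[w]` (no integrability needed,
Bochner integrals are homogeneous). -/
theorem oddNoGoNS_fourierVec_const_smul (c : ℝ) (w : EuclideanSpace ℝ ι → EuclideanSpace ℝ ι) :
    fourierVec (fun x => c • w x) = (c : ℂ) • fourierVec w := by
  unfold fourierVec
  have h : (Literature.Analysis.FunctionSpaces.EuclideanSpace.complexify ∘ fun x => c • w x) =
      (c : ℂ) • (Literature.Analysis.FunctionSpaces.EuclideanSpace.complexify ∘ w) := by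
    funext x
    ext i
    simp only [comp_apply, Pi.smul_apply, PiLp.smul_apply, smul_eq_mul,
      Literature.Analysis.FunctionSpaces.EuclideanSpace.complexify_apply, Complex.ofReal_mul]
  rw [h]
  exact VectorFourier.fourierIntegral_const_smul _ _ _ _ _

/-- The inverse Fourier integral of functions is homogeneous (no integrability needed). -/
theorem oddNoGoNS_fourierInv_const_smul (c : ℂ)
    (G : EuclideanSpace ℝ ι → EuclideanSpace ℂ ι) :
    (𝓕⁻ (c • G) : EuclideanSpace ℝ ι → EuclideanSpace ℂ ι) = c • 𝓕⁻ G := by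
  funext x
  exact congrFun (VectorFourier.fourierIntegral_const_smul _ _ _ G c) x

/-- **The function-level Leray projector is homogeneous**: `P (c • w) = c • P w` for every field
`w` and every real `c` (no Schwartz hypothesis: the Bochner integrals on both sides scale
together, junk values included). -/
theorem oddNoGoNS_lerayProjFun_const_smul (c : ℝ) (w : EuclideanSpace ℝ ι → EuclideanSpace ℝ ι) :
    lerayProjFun (fun x => c • w x) = fun x => c • lerayProjFun w x := by
  funext x
  unfold lerayProjFun
  rw [oddNoGoNS_fourierVec_const_smul]
  have h : (fun ξ => leraySymbolC ξ (((c : ℂ) • fourierVec w) ξ)) =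
      (c : ℂ) • fun ξ => leraySymbolC ξ (fourierVec w ξ) := by
    funext ξ
    rw [Pi.smul_apply, Pi.smul_apply, oddNoGoNS_leraySymbolC_smul]
  rw [h, oddNoGoNS_fourierInv_const_smul, Pi.smul_apply, oddNoGoNS_realPart_ofReal_smul]

/-- The convective derivative is `2`-homogeneous: `((a u)·∇)(b w) = ab (u·∇)w`, pointwise and
without differentiability hypotheses (`fderiv_const_smul_real`). -/
theorem oddNoGoNS_convect_const_smul (a b : ℝ) (u w : EuclideanSpace ℝ ι → EuclideanSpace ℝ ι)
    (x : EuclideanSpace ℝ ι) :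
    convect (fun y => a • u y) (fun y => b • w y) x = (a * b) • convect u w x := by
  rw [convect_apply, convect_apply, fderiv_const_smul_real, smul_apply,
    map_smul, smul_smul, mul_comm b a]

/-- **`eulerBilinear` is bi-homogeneous**: `B(a u, b w) = ab B(u, w)` as functions, for all
fields (junk values included). -/
theorem oddNoGoNS_eulerBilinear_const_smul (a b : ℝ)
    (u w : EuclideanSpace ℝ ι → EuclideanSpace ℝ ι) :
    eulerBilinear (fun y => a • u y) (fun y => b • w y) =
      fun x => (a * b) • eulerBilinear u w x := by
  have hc : (fun x => convect (fun y => a • u y) (fun y => b • w y) x +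
      convect (fun y => b • w y) (fun y => a • u y) x) =
      fun x => (a * b) • (convect u w x + convect w u x) := by
    funext x
    rw [oddNoGoNS_convect_const_smul, oddNoGoNS_convect_const_smul, mul_comm b a, smul_add]
  unfold eulerBilinear
  rw [hc, oddNoGoNS_lerayProjFun_const_smul]
  funext x
  simp only [Pi.smul_apply, smul_smul, mul_comm]

end Leray

/-! ### Homogeneity of jets, of the Laplacian, and of the derivative of a cubic form -/

section Jets

variable {E : Type*} [NormedAddCommGroup E] [NormedSpace ℝ E]
  {F : Type*} [NormedAddCommGroup F] [NormedSpace ℝ F]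

/-- The 3-jet is homogeneous: `J (c • w) x = c • J w x` for every field `w` (no differentiability
needed). -/
theorem oddNoGoNS_jet_const_smul (c : ℝ) (w : E → F) (x : E) :
    ((c • w x, iteratedFDeriv ℝ 1 (fun y => c • w y) x, iteratedFDeriv ℝ 2 (fun y => c • w y) x,
        iteratedFDeriv ℝ 3 (fun y => c • w y) x) :
      F × (E [×1]→L[ℝ] F) × (E [×2]→L[ℝ] F) × (E [×3]→L[ℝ] F)) =
      c • (w x, iteratedFDeriv ℝ 1 w x, iteratedFDeriv ℝ 2 w x, iteratedFDeriv ℝ 3 w x) := by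
  simp only [iteratedFDeriv_const_smul_real, Prod.smul_mk]

/-- The derivative of a differentiable cubic form is `2`-homogeneous:
`Dm(μ z) = μ² Dm(z)` for `μ ≠ 0`. -/
theorem oddNoGoNS_fderiv_cubic {m : F → ℝ} (hm : Differentiable ℝ m)
    (hhom : ∀ (μ : ℝ) (z : F), m (μ • z) = μ ^ 3 * m z) {μ : ℝ} (hμ : μ ≠ 0) (z : F) :
    fderiv ℝ m (μ • z) = μ ^ 2 • fderiv ℝ m z := by
  have h1 : HasFDerivAt (fun w : F => m (μ • w))
      ((fderiv ℝ m (μ • z)).comp (μ • ContinuousLinearMap.id ℝ F)) z :=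
    (hm (μ • z)).hasFDerivAt.comp z ((hasFDerivAt_id z).const_smul μ)
  have h2 : HasFDerivAt (fun w : F => m (μ • w)) (μ ^ 3 • fderiv ℝ m z) z := by
    have : (fun w : F => m (μ • w)) = fun w => μ ^ 3 * m w := funext fun w => hhom μ w
    rw [this]
    exact (hm z).hasFDerivAt.const_mul (μ ^ 3)
  have h := h1.unique h2
  ext w
  have hw := congrArg (fun L : F →L[ℝ] ℝ => L w) h
  simp only [ContinuousLinearMap.comp_apply, smul_apply,
    ContinuousLinearMap.id_apply, map_smul, smul_eq_mul] at hw
  rw [smul_apply, smul_eq_mul]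
  have hw' : μ * fderiv ℝ m (μ • z) w = μ * (μ ^ 2 * fderiv ℝ m z w) := by
    rw [hw]; ring
  exact mul_left_cancel₀ hμ hw'

end Jets

section Laplace

variable {E : Type*} [NormedAddCommGroup E] [InnerProductSpace ℝ E] [FiniteDimensional ℝ E]
  {F : Type*} [NormedAddCommGroup F] [NormedSpace ℝ F]

/-- The Laplacian is homogeneous: `Δ (c • w) = c • Δ w` for every field (no differentiability
needed; `Δ` is a sum of second `iteratedFDeriv`s). -/
theorem oddNoGoNS_laplacian_const_smul (c : ℝ) (w : E → F) :
    (Δ (fun y => c • w y) : E → F) = fun y => c • (Δ w : E → F) y := by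
  rw [InnerProductSpace.laplacian_eq_iteratedFDeriv_stdOrthonormalBasis,
    InnerProductSpace.laplacian_eq_iteratedFDeriv_stdOrthonormalBasis,
    iteratedFDeriv_const_smul_real]
  funext y
  simp only [smul_apply, Finset.smul_sum]

end Laplace

/-! ### The two scaling laws -/

section Scaling

variable {ι : Type*} [Fintype ι]

/-- **`Q` is quartic**: `Q (μ • v) = μ⁴ Q v` for `μ ≠ 0`, for the integrand of the item (written
out; `Q` itself carries an overall minus sign). -/
theorem oddNoGoNS_integral_euler_smul
    {m : EuclideanSpace ℝ ι × (EuclideanSpace ℝ ι [×1]→L[ℝ] EuclideanSpace ℝ ι) ×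
      (EuclideanSpace ℝ ι [×2]→L[ℝ] EuclideanSpace ℝ ι) ×
      (EuclideanSpace ℝ ι [×3]→L[ℝ] EuclideanSpace ℝ ι) → ℝ}
    (hm : Differentiable ℝ m) (hhom : ∀ (μ : ℝ) z, m (μ • z) = μ ^ 3 * m z) {μ : ℝ} (hμ : μ ≠ 0)
    (v : EuclideanSpace ℝ ι → EuclideanSpace ℝ ι) :
    ∫ x, fderiv ℝ m (μ • v x, iteratedFDeriv ℝ 1 (fun y => μ • v y) x,
          iteratedFDeriv ℝ 2 (fun y => μ • v y) x, iteratedFDeriv ℝ 3 (fun y => μ • v y) x)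
        (eulerBilinear (fun y => μ • v y) (fun y => μ • v y) x,
          iteratedFDeriv ℝ 1 (eulerBilinear (fun y => μ • v y) (fun y => μ • v y)) x,
          iteratedFDeriv ℝ 2 (eulerBilinear (fun y => μ • v y) (fun y => μ • v y)) x,
          iteratedFDeriv ℝ 3 (eulerBilinear (fun y => μ • v y) (fun y => μ • v y)) x) =
      μ ^ 4 * ∫ x, fderiv ℝ m (v x, iteratedFDeriv ℝ 1 v x, iteratedFDeriv ℝ 2 v x,
          iteratedFDeriv ℝ 3 v x)
        (eulerBilinear v v x, iteratedFDeriv ℝ 1 (eulerBilinear v v) x,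
          iteratedFDeriv ℝ 2 (eulerBilinear v v) x, iteratedFDeriv ℝ 3 (eulerBilinear v v) x) := by
  rw [← integral_const_mul]
  refine integral_congr_ae (Eventually.of_forall fun x => ?_)
  simp only [oddNoGoNS_eulerBilinear_const_smul]
  rw [oddNoGoNS_jet_const_smul μ v x, oddNoGoNS_jet_const_smul (μ * μ) (eulerBilinear v v) x,
    oddNoGoNS_fderiv_cubic hm hhom hμ, smul_apply, map_smul, smul_eq_mul,
    smul_eq_mul]
  ring

/-- **`V` is cubic**: `V (μ • v) = μ³ V v` for `μ ≠ 0`. -/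
theorem oddNoGoNS_integral_laplacian_smul
    {m : EuclideanSpace ℝ ι × (EuclideanSpace ℝ ι [×1]→L[ℝ] EuclideanSpace ℝ ι) ×
      (EuclideanSpace ℝ ι [×2]→L[ℝ] EuclideanSpace ℝ ι) ×
      (EuclideanSpace ℝ ι [×3]→L[ℝ] EuclideanSpace ℝ ι) → ℝ}
    (hm : Differentiable ℝ m) (hhom : ∀ (μ : ℝ) z, m (μ • z) = μ ^ 3 * m z) {μ : ℝ} (hμ : μ ≠ 0)
    (v : EuclideanSpace ℝ ι → EuclideanSpace ℝ ι) :
    ∫ x, fderiv ℝ m (μ • v x, iteratedFDeriv ℝ 1 (fun y => μ • v y) x,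
          iteratedFDeriv ℝ 2 (fun y => μ • v y) x, iteratedFDeriv ℝ 3 (fun y => μ • v y) x)
        ((Δ (fun y => μ • v y) : EuclideanSpace ℝ ι → EuclideanSpace ℝ ι) x,
          iteratedFDeriv ℝ 1 (Δ (fun y => μ • v y) : EuclideanSpace ℝ ι → EuclideanSpace ℝ ι) x,
          iteratedFDeriv ℝ 2 (Δ (fun y => μ • v y) : EuclideanSpace ℝ ι → EuclideanSpace ℝ ι) x,
          iteratedFDeriv ℝ 3 (Δ (fun y => μ • v y) : EuclideanSpace ℝ ι → EuclideanSpace ℝ ι) x) =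
      μ ^ 3 * ∫ x, fderiv ℝ m (v x, iteratedFDeriv ℝ 1 v x, iteratedFDeriv ℝ 2 v x,
          iteratedFDeriv ℝ 3 v x)
        ((Δ v : EuclideanSpace ℝ ι → EuclideanSpace ℝ ι) x,
          iteratedFDeriv ℝ 1 (Δ v : EuclideanSpace ℝ ι → EuclideanSpace ℝ ι) x,
          iteratedFDeriv ℝ 2 (Δ v : EuclideanSpace ℝ ι → EuclideanSpace ℝ ι) x,
          iteratedFDeriv ℝ 3 (Δ v : EuclideanSpace ℝ ι → EuclideanSpace ℝ ι) x) := by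
  rw [← integral_const_mul]
  refine integral_congr_ae (Eventually.of_forall fun x => ?_)
  simp only [oddNoGoNS_laplacian_const_smul]
  rw [oddNoGoNS_jet_const_smul μ v x, oddNoGoNS_jet_const_smul μ (Δ v) x,
    oddNoGoNS_fderiv_cubic hm hhom hμ, smul_apply, map_smul, smul_eq_mul,
    smul_eq_mul]
  ring

/-! ### Stability of the test class and the limiting argument -/

/-- Schwartz fields are stable under real scalars. -/
theorem oddNoGoNS_isSchwartzField_const_smul {v : EuclideanSpace ℝ ι → EuclideanSpace ℝ ι}
    (hv : IsSchwartzField v) (c : ℝ) :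
    IsSchwartzField (fun y => c • v y) := by
  obtain ⟨f, rfl⟩ := hv
  exact ⟨c • f, rfl⟩

/-- Schwartz fields are differentiable. -/
theorem oddNoGoNS_isSchwartzField_differentiable {v : EuclideanSpace ℝ ι → EuclideanSpace ℝ ι}
    (hv : IsSchwartzField v) :
    Differentiable ℝ v := by
  obtain ⟨f, rfl⟩ := hv
  exact f.differentiable

end Scaling

/-- The elementary limiting step: if `a ≤ t q` for all `t > 0` then `a ≤ 0`. -/
theorem oddNoGoNS_nonpos_of_le_mul {a q : ℝ} (h : ∀ t : ℝ, 0 < t → a ≤ t * q) : a ≤ 0 := by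
  by_contra hcon
  push Not at hcon
  rcases le_or_gt q 0 with hq | hq
  · have h1 := h 1 one_pos
    linarith
  · have h2 := h (a / (2 * q)) (by positivity)
    have : a / (2 * q) * q = a / 2 := by
      field_simp
    linarith

/-! ### The item -/

/-- **Item stmt-NavierStokesRegularity-1378 (`OddNoGoNS`)**, the odd half of the Lyapunov no-go:
for `ν > 0` and a smooth cubic jet density `m`, if `ν V v - Q v ≤ 0` on all divergence-free
Schwartz fields then `V v = 0` and `0 ≤ Q v` on all of them. Proof by amplitude scaling
`v ↦ μ • v`: `Q (μ v) = μ⁴ Q v`, `V (μ v) = μ³ V v`, divide by `μ³` and let `μ → 0±`. -/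
theorem oddMorawetz_oddNoGoNS_proof : Theses.OddMorawetz.OddNoGoNS := by
  intro ν m J Q V hν hm hhom hyp v hv hdiv
  have hmd : Differentiable ℝ m := hm.differentiable (by simp)
  have hJ : ∀ (w : EuclideanSpace ℝ (Fin 3) → EuclideanSpace ℝ (Fin 3))
      (x : EuclideanSpace ℝ (Fin 3)),
      J w x = (w x, iteratedFDeriv ℝ 1 w x, iteratedFDeriv ℝ 2 w x, iteratedFDeriv ℝ 3 w x) :=
    fun _ _ => rfl
  have hQ : ∀ w : EuclideanSpace ℝ (Fin 3) → EuclideanSpace ℝ (Fin 3),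
      Q w = -∫ x, fderiv ℝ m (J w x) (J (eulerBilinear w w) x) :=
    fun _ => rfl
  have hV : ∀ w : EuclideanSpace ℝ (Fin 3) → EuclideanSpace ℝ (Fin 3),
      V w = ∫ x, fderiv ℝ m (J w x) (J (Δ w) x) :=
    fun _ => rfl
  -- the two scaling laws
  have hQs : ∀ μ : ℝ, μ ≠ 0 → Q (fun y => μ • v y) = μ ^ 4 * Q v := by
    intro μ hμ
    rw [hQ, hQ]
    simp only [hJ]
    rw [oddNoGoNS_integral_euler_smul hmd hhom hμ v]
    ring
  have hVs : ∀ μ : ℝ, μ ≠ 0 → V (fun y => μ • v y) = μ ^ 3 * V v := by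
    intro μ hμ
    rw [hV, hV]
    simp only [hJ]
    exact oddNoGoNS_integral_laplacian_smul hmd hhom hμ v
  -- the hypothesis along the ray `μ • v`
  have hray : ∀ μ : ℝ, μ ≠ 0 → ν * (μ ^ 3 * V v) - μ ^ 4 * Q v ≤ 0 := by
    intro μ hμ
    have h := hyp (fun y => μ • v y) (oddNoGoNS_isSchwartzField_const_smul hv μ)
      (VectorCalculus.IsDivFree.const_smul (oddNoGoNS_isSchwartzField_differentiable hv) hdiv μ)
    rwa [hQs μ hμ, hVs μ hμ] at h
  -- divide by `t³` along `t • v` and `(-t) • v`, `t > 0`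
  have hplus : ∀ t : ℝ, 0 < t → ν * V v ≤ t * Q v := by
    intro t ht
    have h := hray t ht.ne'
    have ht3 : (0 : ℝ) < t ^ 3 := by positivity
    have h' : t ^ 3 * (ν * V v) ≤ t ^ 3 * (t * Q v) := by nlinarith [h]
    exact le_of_mul_le_mul_left h' ht3
  have hminus : ∀ t : ℝ, 0 < t → -(ν * V v) ≤ t * Q v := by
    intro t ht
    have h := hray (-t) (neg_ne_zero.mpr ht.ne')
    have e3 : (-t) ^ 3 = -t ^ 3 := by ring
    have e4 : (-t) ^ 4 = t ^ 4 := by ring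
    rw [e3, e4] at h
    have ht3 : (0 : ℝ) < t ^ 3 := by positivity
    have h' : t ^ 3 * (-(ν * V v)) ≤ t ^ 3 * (t * Q v) := by nlinarith [h]
    exact le_of_mul_le_mul_left h' ht3
  have h0 : ν * V v = 0 :=
    le_antisymm (oddNoGoNS_nonpos_of_le_mul hplus)
      (neg_nonpos.mp (oddNoGoNS_nonpos_of_le_mul hminus))
  have hV0 : V v = 0 := (mul_eq_zero.mp h0).resolve_left hν.ne'
  refine ⟨hV0, ?_⟩
  have h := hyp v hv hdiv
  rw [hV0, mul_zero, zero_sub, neg_nonpos] at h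
  exact h

end Summit.NavierStokesRegularity.NavierStokesRegularity.Theorems

end
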